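import Summits.CriticalPhenomena.PercolationContinuityZ3.Theorems.PercNearOneGluingNoHeavyLowerTailNetworkFold
import HarnessLib

/-!
# `NoHeavyLowerTail` (stmt-CriticalPhenomena-4575) — FOLDING A TERMINAL-FREE TWO-TERMINAL NETWORK, part 3:
# the single-edge replacement (effective parameter `p' = X₁/(X₀ + X₁)`) and the R1 reduction

Support file (prover prim-gen-kcluster gen 72; `--supports stmt-CriticalPhenomena-4575`).  No definitions, no named facts, no sorries.
With the notation of part 2 (`…NetworkFold`): the `{u,v}`-wired masses of a weight vector supported on the single pair `uv` are
`X₁' = p' K`, `X₀' = (1 − p') K` (`single_X1`, `single_X0`); hence (`r1_iff_single`) for a network `DX` between `u ≠ v` (joined inside it),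
glued to the rest `DY` at `{u, v}` and containing none of `a, b, c` as inner vertices, and any `𝐩'` that agrees with `𝐩` off the network,
vanishes on the other network pairs and gives the pair `uv` a parameter `p'` with `p' (X₀ + X₁) = X₁`:
R1 for `(a; b, c)` on `φ_{𝐩,q}` (support `DX ∪ DY`) ⟺ R1 for `(a; b, c)` on `φ_{𝐩',q}` (support `{uv} ∪ DY`), every `q > 0`;
and such a `𝐩'` exists (`exists_single_weight`).  So a minimal counterexample to R1-RC(q) has no terminal-free two-terminal subnetwork
with more than one pair (KCLUSTER-gen72 §0).
-/

noncomputable section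

namespace Summit.CriticalPhenomena.PercolationContinuityZ3.Theorems

namespace NetworkFold

open Finset SimpleGraph Literature.Probability.Percolation Literature.Probability.Percolation.Gladkov
open Literature.Probability.Percolation.BHK2006 (weight)
open Literature.Probability.Percolation.DecisionTree (ind ind_of_mem ind_of_not_mem ind_nonneg)
open Literature.Probability.LatticeModels RefinedRowR3 ThreePointLB MeasureTheory
open scoped Classical

variable {V : Type*} [Fintype V]

/-! ### The single-edge network -/

section Single

variable {u v : V} (huv : u ≠ v) (q : ℝ) (wX' : Sym2 V → unitInterval) (g0 : ∀ e, e ≠ s(u, v) → wX' e = 0)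
include huv g0

omit huv in
/-- Off `∅` and `{uv}` a weight vector supported on the pair `uv` gives weight `0`. [folklore] -/
theorem rcWeightW_single_eq_zero (η : BondConfig V) (h0 : η ≠ ∅) (h1 : η ≠ {s(u, v)}) (f : BondConfig V → ℝ) :
    rcWeightW wX' q ({u, v} : Set V) η * f η = 0 := by
  obtain ⟨e, he, hne⟩ : ∃ e ∈ η, e ≠ s(u, v) := by
    by_contra hcon
    push Not at hcon
    rcases Set.eq_empty_or_nonempty η with h | ⟨e, he⟩
    · exact h0 h
    · refine h1 (Set.ext fun f' => ⟨fun hf => ?_, fun hf => ?_⟩)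
      · rw [Set.mem_singleton_iff]; exact hcon f' hf
      · rw [Set.mem_singleton_iff] at hf; rw [hf, ← hcon e he]; exact he
  have hw0 : ∀ f', f' ∉ ({s(u, v)} : Set (Sym2 V)) → (wX' f' : ℝ) = 0 := fun f' hf => by
    rw [g0 f' (fun h => hf (by rw [h]; exact Set.mem_singleton _))]; rfl
  have hz := ApexTwoSum.weight_eq_zero_of_mem_not_mem wX' hw0 he (fun h => hne (Set.mem_singleton_iff.1 h))
  unfold rcWeightW
  rw [hz]; ring

omit huv in
/-- A sum against a weight vector supported on the pair `uv` has two terms. [folklore] -/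
theorem sum_single (f : BondConfig V → ℝ) :
    ∑ η : BondConfig V, rcWeightW wX' q ({u, v} : Set V) η * f η =
      rcWeightW wX' q ({u, v} : Set V) ∅ * f ∅ + rcWeightW wX' q ({u, v} : Set V) {s(u, v)} * f {s(u, v)} := by
  have hne : (∅ : BondConfig V) ≠ {s(u, v)} := fun h => by
    have h' : s(u, v) ∈ (∅ : Set (Sym2 V)) := by rw [h]; exact Set.mem_singleton _
    exact h'
  rw [show rcWeightW wX' q ({u, v} : Set V) ∅ * f ∅ + rcWeightW wX' q ({u, v} : Set V) {s(u, v)} * f {s(u, v)} =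
      ∑ η ∈ ({∅, {s(u, v)}} : Finset (BondConfig V)), rcWeightW wX' q ({u, v} : Set V) η * f η from
    (Finset.sum_pair (f := fun η => rcWeightW wX' q ({u, v} : Set V) η * f η) hne).symm]
  symm
  refine Finset.sum_subset (Finset.subset_univ _) fun η _ hη => ?_
  refine rcWeightW_single_eq_zero q wX' g0 η (fun h => hη ?_) (fun h => hη ?_) f
  · rw [h]; exact Finset.mem_insert_self _ _
  · rw [h]; exact Finset.mem_insert_of_mem (Finset.mem_singleton_self _)

omit [Fintype V] g0 in
/-- The pair `uv` alone has the `{u,v}`-wired count of the empty configuration. [folklore] -/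
theorem clusterCount_single : clusterCount ({s(u, v)} : BondConfig V) ({u, v} : Set V) = clusterCount (∅ : BondConfig V) ({u, v} : Set V) := by
  unfold clusterCount
  have h1 : ({s(u, v)} : BondConfig V) = insert s(u, v) (∅ : BondConfig V) := by
    ext e; simp only [Set.mem_singleton_iff, Set.mem_insert_iff, Set.mem_empty_iff_false, or_false]
  rw [h1, ThreeSum.openGraph_insert, ApexTwoSum.sup_wired_two_eq huv, ApexTwoSum.sup_wired_two_eq huv, sup_assoc, sup_idem]

/-- **Wired mass of `J` for the single pair**: `X₁' = p' · K`. [this work] -/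
theorem single_X1 : (∑ η : BondConfig V, rcWeightW wX' q ({u, v} : Set V) η * ind {η : BondConfig V | v ∈ cl η.toFinset u} η) = (wX' s(u, v) : ℝ) * q ^ clusterCount (∅ : BondConfig V) ({u, v} : Set V) := by
  rw [sum_single q wX' g0]
  have hJ0 : (∅ : BondConfig V) ∉ {η : BondConfig V | v ∈ cl η.toFinset u} := by
    simp only [Set.mem_setOf_eq, Set.toFinset_empty]; exact not_mem_cl_empty huv
  have hJ1 : ({s(u, v)} : BondConfig V) ∈ {η : BondConfig V | v ∈ cl η.toFinset u} := by
    simp only [Set.mem_setOf_eq, Set.toFinset_singleton]; exact mem_cl_single huv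
  have hW1 : weight (fun e => (wX' e : ℝ)) ({s(u, v)} : BondConfig V) = (wX' s(u, v) : ℝ) := by
    unfold weight
    rw [Finset.prod_eq_single s(u, v)]
    · simp only [Set.mem_singleton_iff, if_true]
    · intro f _ hf
      simp only [Set.mem_singleton_iff, hf, if_false, g0 f hf, Set.Icc.coe_zero, sub_zero]
    · intro h; exact absurd (Finset.mem_univ _) h
  rw [ind_of_not_mem hJ0, ind_of_mem hJ1, mul_zero, zero_add, mul_one]
  unfold rcWeightW
  rw [hW1, clusterCount_single huv]

/-- **Wired mass of `¬J` for the single pair**: `X₀' = (1 − p') · K`. [this work] -/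
theorem single_X0 : (∑ η : BondConfig V, rcWeightW wX' q ({u, v} : Set V) η * ind {η : BondConfig V | v ∉ cl η.toFinset u} η) = (1 - (wX' s(u, v) : ℝ)) * q ^ clusterCount (∅ : BondConfig V) ({u, v} : Set V) := by
  rw [sum_single q wX' g0]
  have hJ0 : (∅ : BondConfig V) ∈ {η : BondConfig V | v ∉ cl η.toFinset u} := by
    simp only [Set.mem_setOf_eq, Set.toFinset_empty]; exact not_mem_cl_empty huv
  have hJ1 : ({s(u, v)} : BondConfig V) ∉ {η : BondConfig V | v ∉ cl η.toFinset u} := by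
    simp only [Set.mem_setOf_eq, Set.toFinset_singleton, not_not]; exact mem_cl_single huv
  have hW0 : weight (fun e => (wX' e : ℝ)) (∅ : BondConfig V) = 1 - (wX' s(u, v) : ℝ) := by
    unfold weight
    rw [Finset.prod_eq_single s(u, v)]
    · simp only [Set.mem_empty_iff_false, if_false]
    · intro f _ hf
      simp only [Set.mem_empty_iff_false, if_false, g0 f hf, Set.Icc.coe_zero, sub_zero]
    · intro h; exact absurd (Finset.mem_univ _) h
  rw [ind_of_mem hJ0, ind_of_not_mem hJ1, mul_zero, add_zero, mul_one]
  unfold rcWeightW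
  rw [hW0]

end Single

/-! ### The effective parameter exists -/

/-- **The effective parameter** `p' = X₁/(X₀ + X₁) ∈ [0, 1]`: a weight vector equal to `wY` off the pair `uv` with
`p' (X₀ + X₁) = X₁` on it. [this work] -/
theorem exists_single_weight (wX wY : Sym2 V → unitInterval) {q : ℝ} (hq : 0 < q) (u v : V) :
    ∃ w' : Sym2 V → unitInterval, (∀ e, e ≠ s(u, v) → w' e = wY e) ∧ (w' s(u, v) : ℝ) * ((∑ η : BondConfig V, rcWeightW wX q ({u, v} : Set V) η * ind {η : BondConfig V | v ∉ cl η.toFinset u} η) + (∑ η : BondConfig V, rcWeightW wX q ({u, v} : Set V) η * ind {η : BondConfig V | v ∈ cl η.toFinset u} η)) = (∑ η : BondConfig V, rcWeightW wX q ({u, v} : Set V) η * ind {η : BondConfig V | v ∈ cl η.toFinset u} η) := by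
  have h0 : 0 ≤ (∑ η : BondConfig V, rcWeightW wX q ({u, v} : Set V) η * ind {η : BondConfig V | v ∉ cl η.toFinset u} η) := Finset.sum_nonneg fun η _ => mul_nonneg (rcWeightW_nonneg wX hq.le _ η) (ind_nonneg _ η)
  have h1 : 0 ≤ (∑ η : BondConfig V, rcWeightW wX q ({u, v} : Set V) η * ind {η : BondConfig V | v ∈ cl η.toFinset u} η) := Finset.sum_nonneg fun η _ => mul_nonneg (rcWeightW_nonneg wX hq.le _ η) (ind_nonneg _ η)
  have hsum : (∑ η : BondConfig V, rcWeightW wX q ({u, v} : Set V) η * ind {η : BondConfig V | v ∉ cl η.toFinset u} η) + (∑ η : BondConfig V, rcWeightW wX q ({u, v} : Set V) η * ind {η : BondConfig V | v ∈ cl η.toFinset u} η) = rcPartitionFunctionW wX q ({u, v} : Set V) := by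
    unfold rcPartitionFunctionW
    rw [← Finset.sum_add_distrib]
    refine Finset.sum_congr rfl fun η _ => ?_
    by_cases hη : η ∈ {η : BondConfig V | v ∈ cl η.toFinset u}
    · have hη' : η ∉ {η : BondConfig V | v ∉ cl η.toFinset u} := fun h => h hη
      rw [ind_of_mem hη, ind_of_not_mem hη']; ring
    · have hη' : η ∈ {η : BondConfig V | v ∉ cl η.toFinset u} := hη
      rw [ind_of_not_mem hη, ind_of_mem hη']; ring
  have hpos : 0 < (∑ η : BondConfig V, rcWeightW wX q ({u, v} : Set V) η * ind {η : BondConfig V | v ∉ cl η.toFinset u} η) + (∑ η : BondConfig V, rcWeightW wX q ({u, v} : Set V) η * ind {η : BondConfig V | v ∈ cl η.toFinset u} η) := by rw [hsum]; exact rcPartitionFunctionW_pos wX hq _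
  have hp0 : 0 ≤ (∑ η : BondConfig V, rcWeightW wX q ({u, v} : Set V) η * ind {η : BondConfig V | v ∈ cl η.toFinset u} η) / ((∑ η : BondConfig V, rcWeightW wX q ({u, v} : Set V) η * ind {η : BondConfig V | v ∉ cl η.toFinset u} η) + (∑ η : BondConfig V, rcWeightW wX q ({u, v} : Set V) η * ind {η : BondConfig V | v ∈ cl η.toFinset u} η)) := div_nonneg h1 hpos.le
  have hp1 : (∑ η : BondConfig V, rcWeightW wX q ({u, v} : Set V) η * ind {η : BondConfig V | v ∈ cl η.toFinset u} η) / ((∑ η : BondConfig V, rcWeightW wX q ({u, v} : Set V) η * ind {η : BondConfig V | v ∉ cl η.toFinset u} η) + (∑ η : BondConfig V, rcWeightW wX q ({u, v} : Set V) η * ind {η : BondConfig V | v ∈ cl η.toFinset u} η)) ≤ 1 := div_le_one_of_le₀ (by linarith) hpos.le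
  refine ⟨fun e => if e = s(u, v) then ⟨_, hp0, hp1⟩ else wY e, fun e he => by simp only [if_neg he], ?_⟩
  simp only [if_true]
  exact div_mul_cancel₀ _ hpos.ne'

/-! ### The R1 reduction -/

section Reduction

variable {DX DY : Finset (Sym2 V)} {u v a b c : V} (huv : u ≠ v)
  (hsepD : ∀ z : V, (∃ e ∈ DX, z ∈ e) → (∃ e ∈ DY, z ∈ e) → (z = u ∨ z = v))
  (ha : ∀ e ∈ DX, a ∈ e → (a = u ∨ a = v)) (hb : ∀ e ∈ DX, b ∈ e → (b = u ∨ b = v)) (hc : ∀ e ∈ DX, c ∈ e → (c = u ∨ c = v))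
  (hN : v ∈ cl DX u)
  (w wX wY : Sym2 V → unitInterval) {q : ℝ} (hq : 0 < q)
  (hw : ∀ e, e ∉ (↑DX ∪ ↑DY : Set (Sym2 V)) → (w e : ℝ) = 0)
  (hX : ∀ e ∈ (↑DX : Set (Sym2 V)), wX e = w e) (hX' : ∀ e ∉ (↑DX : Set (Sym2 V)), wX e = 0)
  (hY : ∀ e ∈ (↑DX : Set (Sym2 V)), wY e = 0) (hY' : ∀ e ∉ (↑DX : Set (Sym2 V)), wY e = w e) (he0 : wY s(u, v) = 0)
  (w' : Sym2 V → unitInterval) (gY1 : ∀ e, e ≠ s(u, v) → w' e = wY e)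
  (hp : (w' s(u, v) : ℝ) * ((∑ η : BondConfig V, rcWeightW wX q ({u, v} : Set V) η * ind {η : BondConfig V | v ∉ cl η.toFinset u} η) + (∑ η : BondConfig V, rcWeightW wX q ({u, v} : Set V) η * ind {η : BondConfig V | v ∈ cl η.toFinset u} η)) = (∑ η : BondConfig V, rcWeightW wX q ({u, v} : Set V) η * ind {η : BondConfig V | v ∈ cl η.toFinset u} η))
include huv hsepD ha hb hc hN hq hw hX hX' hY hY' he0 gY1 hp

/-- **R1 reduction by folding a terminal-free two-terminal network into one edge** (every `q > 0`): with `D = DX ∪ DY` and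
`D' = {uv} ∪ DY` given by their membership predicates, R1 for `(a; b, c)` holds for `φ_{𝐩,q}` iff it holds for `φ_{𝐩',q}`. [this work] -/
theorem r1_iff_single {D D' : Finset (Sym2 V)} (hD : ∀ e, e ∈ D ↔ e ∈ DX ∨ e ∈ DY)
    (hD' : ∀ e, e ∈ D' ↔ e = s(u, v) ∨ e ∈ DY) :
    ((rcMeasureW w q ∅).real {η : BondConfig V | b ∈ cl η.toFinset a ∧ c ∈ cl η.toFinset a} * (rcMeasureW w q ∅).real {η : BondConfig V | b ∉ cl η.toFinset a ∧ c ∉ cl η.toFinset a ∧ Sep D (cl η.toFinset a) b c} ≤ (rcMeasureW w q ∅).real {η : BondConfig V | b ∈ cl η.toFinset a ∧ c ∉ cl η.toFinset a} * (rcMeasureW w q ∅).real {η : BondConfig V | b ∉ cl η.toFinset a ∧ c ∈ cl η.toFinset a}) ↔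
      ((rcMeasureW w' q ∅).real {η : BondConfig V | b ∈ cl η.toFinset a ∧ c ∈ cl η.toFinset a} * (rcMeasureW w' q ∅).real {η : BondConfig V | b ∉ cl η.toFinset a ∧ c ∉ cl η.toFinset a ∧ Sep D' (cl η.toFinset a) b c} ≤ (rcMeasureW w' q ∅).real {η : BondConfig V | b ∈ cl η.toFinset a ∧ c ∉ cl η.toFinset a} * (rcMeasureW w' q ∅).real {η : BondConfig V | b ∉ cl η.toFinset a ∧ c ∈ cl η.toFinset a}) := by
  have hD'' : ∀ e, e ∈ D' ↔ e ∈ ({s(u, v)} : Finset (Sym2 V)) ∨ e ∈ DY := fun e => by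
    rw [Finset.mem_singleton]; exact hD' e
  have g0 : ∀ e, e ≠ s(u, v) → (fun e => if e = s(u, v) then w' e else 0) e = 0 := fun e he => by
    simp only [if_neg he]
  refine r1_iff huv hsepD (hsep_single DY) ha (not_inner_single a) hb (not_inner_single b) hc (not_inner_single c)
    hN (mem_cl_single huv) w w' wX (fun e => if e = s(u, v) then w' e else 0) wY hq hw ?_ hX hX' hY hY' ?_ ?_ ?_ ?_ ?_ hD hD''
  · intro e he
    rw [Finset.coe_singleton] at he
    have hne : e ≠ s(u, v) := fun h => he (Set.mem_union_left _ (by rw [h]; exact Set.mem_singleton _))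
    have heY : e ∉ (↑DY : Set (Sym2 V)) := fun h => he (Set.mem_union_right _ h)
    rw [gY1 e hne]
    by_cases heX : e ∈ (↑DX : Set (Sym2 V))
    · rw [hY e heX]; rfl
    · rw [hY' e heX]; exact hw e (fun h => h.elim heX heY)
  · intro e he
    rw [Finset.coe_singleton, Set.mem_singleton_iff] at he
    simp only [he, if_true]
  · intro e he
    rw [Finset.coe_singleton, Set.mem_singleton_iff] at he
    simp only [he, if_false]
  · intro e he
    rw [Finset.coe_singleton, Set.mem_singleton_iff] at he
    rw [he]; exact he0
  · intro e he
    rw [Finset.coe_singleton, Set.mem_singleton_iff] at he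
    exact (gY1 e he).symm
  · rw [single_X1 huv q _ g0, single_X0 huv q _ g0]
    simp only [if_true]
    linear_combination (-(q ^ clusterCount (∅ : BondConfig V) ({u, v} : Set V))) * hp

end Reduction

end NetworkFold

end Summit.CriticalPhenomena.PercolationContinuityZ3.Theorems
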